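import Summits.ABC.IUTFork.Cor312OrbitCoveringWitness
import HarnessLib

/-!
# [IUTchIII] Cor. 3.12 — the ORBIT-COVERING bed COV, VI: what covering NEEDS — an invariant superset bounds the union; isotropic images never cover

Proof-only record file (D-0012; folklore lemmas, no definition, no `Prop` fact, nothing asserted about print) of the abc-iut cell (IUT REPAIR branch B,
sub-cell B3 Joshi, seat abc-iut-rp-j3 gen 3; rung LADDER-ABC:A2.B ⊇ A2.RP). Sequel of `Cor312OrbitCovering{Shells,Lattices,Volumes,Model,Witness}` (the
honest orbit-COVERING bed COV: the UNION of the ⟨(Ind1)∪(Ind2)⟩-images of an ANISOTROPIC honestly `j²`-volumed Θ-lattice IS the q-ball), imported,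
not restated. TAKES NO SIDE on [IUTchIII] Cor. 3.12 or on any author; typed ≠ proved; instantiated ≠ endorsed.

THIS FILE — THE NECESSARY SIDE of the covering mechanism (the kernel form of the beds' scope sentence «covering needs anisotropy»):
* §17 MODEL-FREE (any situation, any setting): the union of the possible images of the Θ-pilot lies inside EVERY indeterminacy-invariant superset of the
  (Ind3)-region (`sUnion_possibleImages_subset_of_invariant`) — so a covering/licence obtained from the UNION can never leave an invariant container
  of the Θ-image (for ball-preserving indeterminacies: the smallest ball containing it);
* §18 IN THE COVERING SHELLS: the orbit-union of a graded lattice of depth vector `k` lies in the ball of depth `min k` (`sUnion_orbit_glat_subset_ball`);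
  hence **if the orbit-union of `glat k` covers the ball `p^e·𝓘` then SOME coordinate of `k` has depth `≤ e`** (`exists_depth_le_of_covers`) — the
  Θ-image must be AS SHALLOW AS the q-image in at least one tensor coordinate —, and **an ISOTROPIC lattice `p^d·𝓘` with `d > e` never covers**
  (`not_covers_of_isotropic`; at honest volume `d = j² ≥ 4 > 1 = e`): the identification-free, volume-free obstruction complementing abc-iut-w5-d068's
  `Cor312PinnedIndTrivial` (isotropic images are (Ind)-FIXED) and abc-iut-w4-d006's `Cor312ScalarIsmDichotomy`;
* §19 AT COV: the Θ-depth profile indeed reaches the q-depth (`thetaDepth_update` = `qDepth`) and spreads from `1` to `25` at `j = 2`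
  (`cov_depth_spread`): minimal depth = q-depth, average depth = `j²` — the shape the covering form of Joshi's locus / the Licence-by-union needs.
HONEST SCOPE: interface-level toy; whether [IUTchI] Def. 3.1 Θ-pilot Kummer images have a tensor coordinate as shallow as the q-pilot's is NOT modelled
(no side taken). S. Mochizuki, *Inter-universal Teichmüller theory III*, kurims manuscript (May 2020) = `paper:url-4b091feeb646` (cell render).
[claim: Mochizuki2012, status: disputed] for every IUT noun. [cite: ScholzeStix2018, §2.2 pp. 9–10]
-/

noncomputable section

open Set

namespace Summit.ABC.IUTFork.Cor312Vol

namespace CoveringWitness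

open Thm311 Cor312 Cor312.Checks Cor312.IdentifiedNonVacuity Literature.IUT.LogThetaLattice

/-! ## 17. Model-free: the union of the possible images stays inside every invariant superset of the Θ-region -/

section General

variable {T : ThetaIndex} (S : Situation T) (P : Cor312.Setting S)

/-- **MODEL-FREE BOUND ON THE UNION.** If `B ⊇ thetaRegion3` is mapped into itself by every element of ⟨(Ind1) ∪ (Ind2)⟩, then the union of the
possible images of the Θ-pilot at `(j, v_ℚ)` lies in `B`. (For ball-preserving indeterminacies: inside the smallest ball containing the Θ-image.)
[folklore] -/
theorem sUnion_possibleImages_subset_of_invariant {j : T.Label} {vQ : T.VQ} {B : Set (S.L.Packet j vQ)} (hB : P.thetaRegion3 j vQ ⊆ B)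
    (hinv : ∀ Φ ∈ Setting.indGroup S, Φ j vQ '' B ⊆ B) : ⋃₀ P.possibleImages j vQ ⊆ B := by
  rintro x ⟨U, ⟨Φ, hΦ, rfl⟩, hx⟩
  exact hinv Φ hΦ (Set.image_mono hB hx)

/-- … hence a q-region COVERED by the union (the shape of the Licence-by-union / of Joshi's locus in covering form) lies in every such `B`:
the covering can only reach as far as the invariant hull of the Θ-image. [folklore] -/
theorem subset_of_covered_of_invariant {j : T.Label} {vQ : T.VQ} {B Q : Set (S.L.Packet j vQ)} (hB : P.thetaRegion3 j vQ ⊆ B)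
    (hinv : ∀ Φ ∈ Setting.indGroup S, Φ j vQ '' B ⊆ B) (hQ : Q ⊆ ⋃₀ P.possibleImages j vQ) : Q ⊆ B :=
  hQ.trans (sUnion_possibleImages_subset_of_invariant S P hB hinv)

end General

/-! ## 18. In the covering shells: depth bounds for orbit-unions; isotropic lattices never cover a shallower ball -/

variable (p : ℕ) [hp : Fact p.Prime] {j : toyIndex.Label} {vQ : toyIndex.VQ}

omit hp in
/-- A graded lattice lies in the ball of any depth below all its depths. [folklore] -/
theorem glat_subset_ball_of_le {k : Idx j → ℕ} {d : ℕ} (hd : ∀ c, d ≤ k c) : glat p vQ k ⊆ ball p j vQ d :=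
  glat_antitone p vQ hd

omit hp in
/-- **The orbit-union of a graded lattice lies in the ball of depth `min k`**: every indeterminacy maps the ball onto itself
(`image_ball_of_mem_closure`). [folklore] -/
theorem sUnion_orbit_glat_subset_ball {k : Idx j → ℕ} {d : ℕ} (hd : ∀ c, d ≤ k c) :
    ⋃₀ {U | ∃ Φ ∈ covGroup, U = Φ j vQ '' glat p vQ k} ⊆ ball p j vQ d := by
  rintro x ⟨U, ⟨Φ, hΦ, rfl⟩, hx⟩
  rw [← image_ball_of_mem_closure p hΦ j vQ d]
  exact Set.image_mono (glat_subset_ball_of_le p hd) hx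

/-- **WHAT COVERING NEEDS**: if the orbit-union of `glat k` covers the ball `p^e·𝓘`, then SOME coordinate of `k` has depth `≤ e` — the Θ-image must
be as SHALLOW as the covered ball in at least one tensor coordinate. [folklore] -/
theorem exists_depth_le_of_covers {k : Idx j → ℕ} {e : ℕ} (h : ball p j vQ e ⊆ ⋃₀ {U | ∃ Φ ∈ covGroup, U = Φ j vQ '' glat p vQ k}) :
    ∃ c, k c ≤ e := by
  by_contra hne
  push Not at hne
  have hsub : ball p j vQ e ⊆ ball p j vQ (e + 1) :=
    h.trans (sUnion_orbit_glat_subset_ball p fun c => hne c)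
  exact absurd ((ball_subset_ball_iff p vQ e (e + 1)).1 hsub) (by omega)

/-- **ISOTROPIC IMAGES NEVER COVER**: the orbit-union of the ball `p^d·𝓘` is `p^d·𝓘` itself, so it covers `p^e·𝓘` only if `d ≤ e`; at honest volume
(`d = j² > e = 1` for `j ≥ 2`) it does not. (The volume-free, identification-free core of «covering needs anisotropy»; cf. abc-iut-w5-d068
`Cor312PinnedIndTrivial`: such images are (Ind)-fixed.) [folklore] -/
theorem not_covers_of_isotropic {d e : ℕ} (hde : e < d) :
    ¬ ball p j vQ e ⊆ ⋃₀ {U | ∃ Φ ∈ covGroup, U = Φ j vQ '' ball p j vQ d} := fun h => by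
  obtain ⟨_, hc⟩ := exists_depth_le_of_covers p (k := fun _ : Idx j => d) h
  exact absurd hc (by omega)

/-! ## 19. At COV the Θ-depth profile reaches the q-depth and spreads up to `25` -/

/-- At COV covering holds, so the necessary condition is met: some Θ-depth is `≤ qDepth j` (indeed `thetaDepth (czero[0 ↦ 1]) = qDepth j`). [folklore] -/
theorem cov_exists_thetaDepth_le (j : toyIndex.Label) : ∃ c, thetaDepth j c ≤ qDepth j :=
  ⟨Function.update (czero j) 0 1, (thetaDepth_update j).le⟩

/-- **The DEPTH SPREAD of the honest covering Θ-image at `j = 2`**: minimal depth `1` (= the q-depth, on the coordinate `(1,0,0)`), depth `25` on the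
all-zero coordinate, average depth `4 = j²` (`sum_thetaDepth`: total `32` over `8` coordinates). [folklore] -/
theorem cov_depth_spread :
    thetaDepth (Setting.labelSucc (T := toyIndex) ⟨1, PinnedWitness.one_lt_lstar⟩) (Function.update (czero _) 0 1) = 1 ∧
      thetaDepth (Setting.labelSucc (T := toyIndex) ⟨1, PinnedWitness.one_lt_lstar⟩) (czero _) = 25 ∧
      ∑ c, thetaDepth (Setting.labelSucc (T := toyIndex) ⟨1, PinnedWitness.one_lt_lstar⟩) c = 32 := by
  have hj : (Setting.labelSucc (T := toyIndex) ⟨1, PinnedWitness.one_lt_lstar⟩) ≠ 0 := Setting.labelSucc_ne_zero _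
  refine ⟨?_, ?_, ?_⟩
  · rw [thetaDepth_update]; unfold qDepth; rw [if_neg hj]
  · unfold thetaDepth; rw [if_neg hj, if_pos rfl]; norm_num [Setting.labelSucc]
  · rw [sum_thetaDepth hj]; norm_num [Setting.labelSucc]

end CoveringWitness

end Summit.ABC.IUTFork.Cor312Vol

end
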